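import Mathlib
import Literature.NumberTheory.Irrationality.Lai2025TwoAdic.TwoAdicValuation
import Literature.NumberTheory.Irrationality.PAdicZetaValues.Criterion
import Literature.NumberTheory.Irrationality.PAdicZetaValues.Records
import Literature.NumberTheory.Transcendental.ZetaLinearFormsCriterion
import HarnessLib

/-!
# Lai 2025 (IJNT), Theorem 1.3 at `s = 0`: `ζ₂(3, ¼) ∉ ℚ`, hence Calegari's `ζ₂(3) ∉ ℚ` — PROVED
# (discharge of the named fact `PAdicZetaValues.calegari2005_theorem33`)

Topic `Literature/NumberTheory/Irrationality/Lai2025TwoAdic`.  Sources: L. Lai, *On the irrationality of certain `2`-adic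
zeta values*, Int. J. Number Theory (2025) = arXiv:2304.00816 [Lai2025TwoAdicZeta], §7 "Proofs of the main results"
(held text `paper:arxiv-2304.00816`, chunk p0013, read on the page) and §1 («The special case `s = 0` of Theorem 1.3 gives
an alternative proof of the irrationality of `ζ₂(3)`»); F. Calegari, *Irrationality of certain `p`-adic periods for
small `p`*, IMRN 2005:20 (2005) 1235–1249 = arXiv:math/0408214 [Calegari2005], Theorem 3.3 («If `p = 2` then `ζ_p(3) ∉ ℚ`»).
PROOF FILE (theorems only; no definition, no named fact); file 4 of 4: it assembles `RationalFunctionB.lean`,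
`LinearFormsT.lean`, `TwoAdicValuation.lean` and DISCHARGES `Literature.NumberTheory.Irrationality.PAdicZetaValues.calegari2005_theorem33`
(net debt −1).  Calegari's own proof (overconvergent `2`-adic modular forms) is not the road taken: the tree follows the
printed elementary proof of [Lai2025TwoAdicZeta].

## Source, as printed ([Lai2025TwoAdicZeta, §7, proof of Theorem 1.3], `s = 0`)

«Combining Lemma 3.3, Lemma 4.5 and Lemma 4.6, we obtain that: `d_n^{2s+3}T_n` is a linear combination of `1`,
`ζ₂(j,¼)` (`s+3 ≤ j ≤ 2s+3`) with integer coefficients.  By (d_n_est) [`d_n = e^{(1+o(1))n}`], Lemma 5.2 and Lemma 6.3,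
when `n = 2^m − 1 → ∞` we have `max_{0≤i≤s+2} |d_n^{2s+3}σ_{n,i}| · |d_n^{2s+3}T_n|₂ ≤ exp(((2 − 3 log 2)s + 3 − 6 log 2 + o(1))n) → 0`,
and importantly `d_n^{2s+3}T_n ≠ 0`.  Applying Lemma 2.1 we deduce that the following set contains at least one irrational
number: `{ζ₂(j,¼) | j ∈ ℤ ∩ [s+3, 2s+3]}`.»  At `s = 0` the set is `{ζ₂(3,¼)}`, and «by Lemma 2.7» (`ζ₂(j) = ½ζ₂(j,¼)` for odd
`j ≥ 3`) `ζ₂(3) ∉ ℚ`.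

## What is formalised (all PROVED)

* `linearForm_eq` — `d_n³σ_{n,0} + d_n³σ_{n,2}·ζ₂(3,¼) = d_n³·T_n` in `ℚ₂`, where `d_n³σ_{n,0}, d_n³σ_{n,2} ∈ ℤ`
  (Lemmas 4.5–4.6, `LinearFormsT.exists_int_lcm_pow_mul_sigma0`, `exists_int_lcm_pow_mul_sigma2`);
* `tendsto_bound_mersenne` — along `n = 2^m − 1`: `max(|d_n³σ_{n,0}|, |d_n³σ_{n,2}|)·‖d_n³T_n‖₂ ≤
  d_n³·(n+1)²(160n+160)·2^{6n}·2^{3m−12n−4} → 0` (tree PNT `Transcendental.eventually_lcmUpto_mul_pow_le_exp`: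
  `d_n³ ≤ e^{(3+η)n}`; `2^{3m} = (n+1)³`; `3.05 − 6 log 2 < −1`);
* `isIrrational_padicHurwitzZeta_two_three_quarter` — **Theorem 1.3 at `s = 0`: `ζ₂(3,¼) ∉ ℚ`** by the tree's
  Lemma 2.1 (`PAdicZetaValues.exists_isIrrational_of_linearForms`) with `T_n ≠ 0` (`TwoAdicValuation.T_mersenne_ne_zero`);
* **`PAdicZetaValues.calegari2005_theorem33_holds : calegari2005_theorem33`** — `ζ₂(3) ∉ ℚ` for the TREE's
  `padicZetaValue 2 3`, through the discharged Lemma 2.7 `lai2025TwoAdic_lemma27_two_holds` (`ζ₂(3) = ½ζ₂(3,¼)`).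

Cell zeta5-irr / pub-zeta5 (HONEST FRAMING: systematic search; no irrationality claim unless kernel-certified): this is
the kernel-certified `2`-ADIC statement `ζ₂(3) ∉ ℚ` (Calegari 2005); it says nothing about the real number `ζ(5)`, nor
about `ζ(3) ∈ ℝ` (Apéry).
-/

noncomputable section

open Finset Filter Topology
open Literature.NumberTheory.LocalFields
open Literature.NumberTheory.Transcendental
open Literature.NumberTheory.Irrationality.PAdicZetaValues
open scoped Nat

namespace Literature.NumberTheory.Irrationality.Lai2025TwoAdic

/-! ## §1. The integer linear forms `d_n³σ_{n,0} + d_n³σ_{n,2}·ζ₂(3,¼) = d_n³T_n` -/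

/-- `d_n³σ_{n,2} ∈ ℤ` (Lemma 4.5: even `σ_{n,2} ∈ ℤ`; `d_n³σ_{n,0} ∈ ℤ` is `exists_int_lcm_pow_mul_sigma0`, Lemma 4.6).
[cite: Lai2025TwoAdicZeta, Lemma 4.5 and §7 (proof of Thm 1.3: "d_n^{2s+3}T_n is a linear combination … with integer coefficients")] -/
theorem exists_int_lcm_pow_mul_sigma2 (n : ℕ) : ∃ z : ℤ, (Nat.lcmUpto n : ℚ) ^ 3 * sigma2 n = z := by
  obtain ⟨z, hz⟩ := exists_int_sigma2 n
  exact ⟨(Nat.lcmUpto n : ℤ) ^ 3 * z, by rw [hz]; push_cast; ring⟩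

/-- **The linear form**: `d_n³σ_{n,0} + d_n³σ_{n,2} · ζ₂(3,¼) = d_n³ · T_n` in `ℚ₂` (Lemma 3.3 times `d_n³`).
[cite: Lai2025TwoAdicZeta, §7 (proof of Thm 1.3, first sentence) with Lemma 3.3] -/
theorem linearForm_eq (n : ℕ) :
    (((Nat.lcmUpto n : ℚ) ^ 3 * sigma0 n : ℚ) : ℚ_[2]) +
        (((Nat.lcmUpto n : ℚ) ^ 3 * sigma2 n : ℚ) : ℚ_[2]) * padicHurwitzZeta 2 3 (4 : ℚ_[2])⁻¹ =
      ((Nat.lcmUpto n : ℚ) : ℚ_[2]) ^ 3 * T n := by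
  rw [T_eq]
  push_cast
  ring

/-- The linear form does not vanish along `n = 2^m − 1` («and importantly `d_n^{2s+3}T_n ≠ 0`»).
[cite: Lai2025TwoAdicZeta, §7 (proof of Thm 1.3) with Lemma 6.3] -/
theorem linearForm_mersenne_ne_zero {m : ℕ} (hm : 1 ≤ m) :
    (((Nat.lcmUpto (2 ^ m - 1) : ℚ) ^ 3 * sigma0 (2 ^ m - 1) : ℚ) : ℚ_[2]) +
        (((Nat.lcmUpto (2 ^ m - 1) : ℚ) ^ 3 * sigma2 (2 ^ m - 1) : ℚ) : ℚ_[2]) *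
          padicHurwitzZeta 2 3 (4 : ℚ_[2])⁻¹ ≠ 0 := by
  rw [linearForm_eq]
  refine mul_ne_zero (pow_ne_zero _ ?_) (T_mersenne_ne_zero hm)
  exact_mod_cast (Nat.lcmUpto_pos (2 ^ m - 1)).ne'

/-! ## §2. The sizes: `max(|d_n³σ_{n,0}|,|d_n³σ_{n,2}|)·‖d_n³T_n‖₂ → 0` along `n = 2^m − 1` -/

/-- A common polynomial majorant: `max(|σ_{n,0}|, |σ_{n,2}|) ≤ (n+1)²(160n+160)·2^{6n}`. [cite: Lai2025TwoAdicZeta, Lemma 5.2 (sigma_est) at s = 0] -/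
theorem abs_sigma_le (n : ℕ) :
    max |sigma0 n| |sigma2 n| ≤ ((n : ℚ) + 1) ^ 2 * (160 * n + 160) * (2 : ℚ) ^ (6 * n) := by
  have hn : (0 : ℚ) ≤ n := Nat.cast_nonneg n
  have h2 : (0 : ℚ) ≤ 2 ^ (6 * n) := by positivity
  refine max_le ((abs_sigma0_le n).trans ?_) ((abs_sigma2_le n).trans ?_)
  · nlinarith [sq_nonneg ((n : ℚ) + 1), mul_nonneg (mul_nonneg (sq_nonneg ((n : ℚ) + 1)) (by positivity : (0:ℚ) ≤ 32)) h2]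
  · nlinarith [sq_nonneg ((n : ℚ) + 1), mul_nonneg hn h2, mul_nonneg (mul_nonneg hn hn) h2,
      mul_nonneg (mul_nonneg (mul_nonneg hn hn) hn) h2]

/-- The Archimedean size of the (integer) coefficients along `n`:
`max(|d_n³σ_{n,0}|, |d_n³σ_{n,2}|) ≤ d_n³·(n+1)²(160n+160)·2^{6n}` (in `ℝ`). [cite: Lai2025TwoAdicZeta, §7 (proof of Thm 1.3: (d_n_est) and Lemma 5.2)] -/
theorem max_abs_coeff_le (n : ℕ) :
    max (|(((Nat.lcmUpto n : ℚ) ^ 3 * sigma0 n : ℚ) : ℝ)|) (|(((Nat.lcmUpto n : ℚ) ^ 3 * sigma2 n : ℚ) : ℝ)|) ≤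
      (Nat.lcmUpto n : ℝ) ^ 3 * (((n : ℝ) + 1) ^ 2 * (160 * n + 160) * (2 : ℝ) ^ (6 * n)) := by
  have h := abs_sigma_le n
  have hq : max (|(Nat.lcmUpto n : ℚ) ^ 3 * sigma0 n|) (|(Nat.lcmUpto n : ℚ) ^ 3 * sigma2 n|) ≤
      (Nat.lcmUpto n : ℚ) ^ 3 * (((n : ℚ) + 1) ^ 2 * (160 * n + 160) * (2 : ℚ) ^ (6 * n)) := by
    rw [abs_mul, abs_mul, abs_of_nonneg (by positivity : (0 : ℚ) ≤ (Nat.lcmUpto n : ℚ) ^ 3),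
      ← mul_max_of_nonneg _ _ (by positivity)]
    exact mul_le_mul_of_nonneg_left h (by positivity)
  have := (Rat.cast_le (K := ℝ)).2 hq
  push_cast at this ⊢
  exact this

/-- The `2`-adic size of the linear form along `n = 2^m − 1`: `‖d_n³T_n‖₂ ≤ 2^{3m − 12n − 4}` (`‖d_n³‖₂ ≤ 1`).
[cite: Lai2025TwoAdicZeta, §7 (proof of Thm 1.3) with Lemma 6.3] -/
theorem norm_linearForm_mersenne_le {m : ℕ} (hm : 1 ≤ m) :
    ‖(((Nat.lcmUpto (2 ^ m - 1) : ℚ) ^ 3 * sigma0 (2 ^ m - 1) : ℚ) : ℚ_[2]) +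
        (((Nat.lcmUpto (2 ^ m - 1) : ℚ) ^ 3 * sigma2 (2 ^ m - 1) : ℚ) : ℚ_[2]) *
          padicHurwitzZeta 2 3 (4 : ℚ_[2])⁻¹‖ ≤
      (2 : ℝ) ^ (3 * (m : ℤ) - 12 * ((2 ^ m - 1 : ℕ) : ℤ) - 4) := by
  rw [linearForm_eq, norm_mul, norm_pow]
  have hd : ‖((Nat.lcmUpto (2 ^ m - 1) : ℚ) : ℚ_[2])‖ ≤ 1 := by
    have := Padic.norm_int_le_one (p := 2) (Nat.lcmUpto (2 ^ m - 1) : ℤ)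
    push_cast at this ⊢
    exact this
  calc ‖((Nat.lcmUpto (2 ^ m - 1) : ℚ) : ℚ_[2])‖ ^ 3 * ‖T (2 ^ m - 1)‖
      ≤ 1 ^ 3 * (2 : ℝ) ^ (3 * (m : ℤ) - 12 * ((2 ^ m - 1 : ℕ) : ℤ) - 4) :=
        mul_le_mul (pow_le_pow_left₀ (norm_nonneg _) hd 3) (norm_T_mersenne_le hm) (norm_nonneg _) (by positivity)
    _ = _ := by rw [one_pow, one_mul]

/-- `n_m := 2^m − 1 → ∞`. [folklore] -/
private theorem tendsto_mersenne : Tendsto (fun m : ℕ => 2 ^ m - 1) atTop atTop := by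
  refine tendsto_atTop_mono (fun m => ?_) tendsto_id
  have : m < 2 ^ m := Nat.lt_two_pow_self
  show m ≤ 2 ^ m - 1
  omega

/-- The polynomial–exponential majorant tends to `0`: `e^{(3+1/20)n}·(n+1)⁵(160n+160)·2^{6n}·2^{−12n} → 0`
(`3.05 − 6 log 2 < −1`). [cite: Lai2025TwoAdicZeta, §7 (proof of Thm 1.3: "(because … 3 − 6 log 2 < 0)")] -/
theorem tendsto_majorant :
    Tendsto (fun n : ℕ => Real.exp ((3 + 1 / 20) * n) * (((n : ℝ) + 1) ^ 5 * (160 * n + 160)) *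
      (2 : ℝ) ^ (6 * (n : ℤ) - 12 * n)) atTop (𝓝 0) := by
  -- `(n+1)^6 e^{−(n+1)} → 0`
  have h6 : Tendsto (fun n : ℕ => ((n : ℝ) + 1) ^ 6 * Real.exp (-((n : ℝ) + 1))) atTop (𝓝 0) := by
    have h := (Real.tendsto_pow_mul_exp_neg_atTop_nhds_zero 6).comp
      (tendsto_atTop_add_const_right atTop (1 : ℝ) tendsto_natCast_atTop_atTop)
    exact h.congr fun n => rfl
  have hlog := Real.log_two_gt_d9
  -- comparison: the majorant is `≤ 160·e·(n+1)^6 e^{−(n+1)}`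
  have hle : ∀ n : ℕ, Real.exp ((3 + 1 / 20) * n) * (((n : ℝ) + 1) ^ 5 * (160 * n + 160)) *
      (2 : ℝ) ^ (6 * (n : ℤ) - 12 * n) ≤ 160 * Real.exp 1 * (((n : ℝ) + 1) ^ 6 * Real.exp (-((n : ℝ) + 1))) := by
    intro n
    have hn : (0 : ℝ) ≤ n := Nat.cast_nonneg n
    -- `2^{6n−12n} = 2^{−6n} = exp(−6n log 2) ≤ exp(−4.15 n)`
    have h2 : (2 : ℝ) ^ (6 * (n : ℤ) - 12 * n) = Real.exp (-(6 * n) * Real.log 2) := by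
      rw [show (6 * (n : ℤ) - 12 * n) = -(6 * n : ℕ) by push_cast; ring, zpow_neg, zpow_natCast,
        ← Real.exp_log (by positivity : (0 : ℝ) < 2 ^ (6 * n)), Real.log_pow, ← Real.exp_neg]
      congr 1; push_cast; ring
    have hpoly : ((n : ℝ) + 1) ^ 5 * (160 * n + 160) = 160 * ((n : ℝ) + 1) ^ 6 := by ring
    rw [h2, hpoly]
    have hexp : Real.exp ((3 + 1 / 20) * n) * Real.exp (-(6 * n) * Real.log 2) ≤
        Real.exp 1 * Real.exp (-((n : ℝ) + 1)) := by
      rw [← Real.exp_add, ← Real.exp_add]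
      exact Real.exp_le_exp.2 (by nlinarith)
    calc Real.exp ((3 + 1 / 20) * n) * (160 * ((n : ℝ) + 1) ^ 6) * Real.exp (-(6 * n) * Real.log 2)
        = 160 * ((n : ℝ) + 1) ^ 6 * (Real.exp ((3 + 1 / 20) * n) * Real.exp (-(6 * n) * Real.log 2)) := by ring
      _ ≤ 160 * ((n : ℝ) + 1) ^ 6 * (Real.exp 1 * Real.exp (-((n : ℝ) + 1))) :=
          mul_le_mul_of_nonneg_left hexp (by positivity)
      _ = 160 * Real.exp 1 * (((n : ℝ) + 1) ^ 6 * Real.exp (-((n : ℝ) + 1))) := by ring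
  have hlim := h6.const_mul (160 * Real.exp 1)
  rw [mul_zero] at hlim
  exact squeeze_zero (fun n => by positivity) hle hlim

/-- **The sizes multiply to `o(1)`** along `n = 2^m − 1`:
`max(|d_n³σ_{n,0}|,|d_n³σ_{n,2}|)·‖d_n³σ_{n,0} + d_n³σ_{n,2}ζ₂(3,¼)‖₂ → 0` («`≤ exp((3 − 6 log 2 + o(1))n) → 0`»).
[cite: Lai2025TwoAdicZeta, §7 (proof of Thm 1.3, the displayed estimate)] -/
theorem tendsto_bound_mersenne :
    Tendsto (fun m : ℕ =>
      max (|(((Nat.lcmUpto (2 ^ m - 1) : ℚ) ^ 3 * sigma0 (2 ^ m - 1) : ℚ) : ℝ)|)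
          (|(((Nat.lcmUpto (2 ^ m - 1) : ℚ) ^ 3 * sigma2 (2 ^ m - 1) : ℚ) : ℝ)|) *
        ‖(((Nat.lcmUpto (2 ^ m - 1) : ℚ) ^ 3 * sigma0 (2 ^ m - 1) : ℚ) : ℚ_[2]) +
            (((Nat.lcmUpto (2 ^ m - 1) : ℚ) ^ 3 * sigma2 (2 ^ m - 1) : ℚ) : ℚ_[2]) *
              padicHurwitzZeta 2 3 (4 : ℚ_[2])⁻¹‖)
      atTop (𝓝 0) := by
  -- PNT: `d_n³ ≤ e^{(3 + 1/20)n}` for large `n`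
  have hpnt : ∀ᶠ n : ℕ in atTop, ((Nat.lcmUpto n : ℝ)) ^ 3 ≤ Real.exp ((3 + 1 / 20) * n) := by
    have h := eventually_lcmUpto_mul_pow_le_exp 1 3 (ε := 1 / 20) (by norm_num)
    filter_upwards [h] with n hn
    rw [one_mul] at hn
    refine hn.trans (le_of_eq ?_)
    congr 1; push_cast; ring
  have hpnt' := tendsto_mersenne.eventually hpnt
  have hmaj := tendsto_majorant.comp tendsto_mersenne
  refine squeeze_zero' (Eventually.of_forall fun m => by positivity) ?_ hmaj
  filter_upwards [hpnt', eventually_ge_atTop 1] with m hd hm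
  set n : ℕ := 2 ^ m - 1 with hn
  have h1 := max_abs_coeff_le n
  have h2 := norm_linearForm_mersenne_le hm
  have hn1 : ((n : ℝ) + 1) = (2 : ℝ) ^ m := by
    rw [hn, Nat.cast_sub Nat.one_le_two_pow]; push_cast; ring
  -- `2^{3m − 12n − 4} = (n+1)³ · 2^{−12n} / 16 ≤ (n+1)³ · 2^{6n − 12n} · 2^{−6n}`… combine
  have hkey : (Nat.lcmUpto n : ℝ) ^ 3 * (((n : ℝ) + 1) ^ 2 * (160 * n + 160) * (2 : ℝ) ^ (6 * n)) *
      (2 : ℝ) ^ (3 * (m : ℤ) - 12 * (n : ℤ) - 4) ≤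
      Real.exp ((3 + 1 / 20) * n) * (((n : ℝ) + 1) ^ 5 * (160 * n + 160)) * (2 : ℝ) ^ (6 * (n : ℤ) - 12 * n) := by
    have e3 : (2 : ℝ) ^ (3 * (m : ℤ) - 12 * (n : ℤ) - 4) = ((n : ℝ) + 1) ^ 3 * (2 : ℝ) ^ (-(12 * (n : ℤ)) - 4) := by
      rw [hn1, ← pow_mul, ← zpow_natCast (2 : ℝ) (m * 3), ← zpow_add₀ two_ne_zero]
      congr 1; push_cast; ring
    have e6 : (2 : ℝ) ^ (6 * n) * (2 : ℝ) ^ (-(12 * (n : ℤ)) - 4) ≤ (2 : ℝ) ^ (6 * (n : ℤ) - 12 * n) := by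
      rw [← zpow_natCast, ← zpow_add₀ two_ne_zero]
      exact zpow_le_zpow_right₀ (by norm_num) (by push_cast; omega)
    calc (Nat.lcmUpto n : ℝ) ^ 3 * (((n : ℝ) + 1) ^ 2 * (160 * n + 160) * (2 : ℝ) ^ (6 * n)) *
          (2 : ℝ) ^ (3 * (m : ℤ) - 12 * (n : ℤ) - 4)
        = (Nat.lcmUpto n : ℝ) ^ 3 * (((n : ℝ) + 1) ^ 5 * (160 * n + 160)) *
            ((2 : ℝ) ^ (6 * n) * (2 : ℝ) ^ (-(12 * (n : ℤ)) - 4)) := by rw [e3]; ring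
      _ ≤ Real.exp ((3 + 1 / 20) * n) * (((n : ℝ) + 1) ^ 5 * (160 * n + 160)) * (2 : ℝ) ^ (6 * (n : ℤ) - 12 * n) := by
          gcongr
  calc max (|(((Nat.lcmUpto n : ℚ) ^ 3 * sigma0 n : ℚ) : ℝ)|) (|(((Nat.lcmUpto n : ℚ) ^ 3 * sigma2 n : ℚ) : ℝ)|) *
        ‖(((Nat.lcmUpto n : ℚ) ^ 3 * sigma0 n : ℚ) : ℚ_[2]) +
            (((Nat.lcmUpto n : ℚ) ^ 3 * sigma2 n : ℚ) : ℚ_[2]) * padicHurwitzZeta 2 3 (4 : ℚ_[2])⁻¹‖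
      ≤ (Nat.lcmUpto n : ℝ) ^ 3 * (((n : ℝ) + 1) ^ 2 * (160 * n + 160) * (2 : ℝ) ^ (6 * n)) *
          (2 : ℝ) ^ (3 * (m : ℤ) - 12 * (n : ℤ) - 4) :=
        mul_le_mul h1 h2 (norm_nonneg _) (by positivity)
    _ ≤ _ := hkey

/-! ## §3. Theorem 1.3 at `s = 0` and Calegari's Theorem 3.3 -/

/-- **Theorem 1.3 at `s = 0`: `ζ₂(3, ¼)` is irrational** (`ζ₂(3,¼)` = the tree's `padicHurwitzZeta 2 3 4⁻¹`), by Lemma 2.1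
(tree `exists_isIrrational_of_linearForms`) applied to the integer forms `d_n³σ_{n,0} + d_n³σ_{n,2}ζ₂(3,¼)`, `n = 2^m − 1`.
[cite: Lai2025TwoAdicZeta, Thm 1.3 (case s = 0) and §7 (its proof)] -/
theorem isIrrational_padicHurwitzZeta_two_three_quarter :
    IsIrrational 2 (padicHurwitzZeta 2 3 (4 : ℚ_[2])⁻¹) := by
  classical
  set ξ : Fin 2 → ℚ_[2] := ![1, padicHurwitzZeta 2 3 (4 : ℚ_[2])⁻¹] with hξ
  have hforms : ∀ a b : ℤ, (∑ i, ((![a, b] i : ℤ) : ℚ_[2]) * ξ i) =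
      (a : ℚ_[2]) + (b : ℚ_[2]) * padicHurwitzZeta 2 3 (4 : ℚ_[2])⁻¹ := by
    intro a b
    simp [hξ, Fin.sum_univ_two]
  have h := exists_isIrrational_of_linearForms (p := 2) ξ fun ε hε => by
    obtain ⟨m, hm, hm1⟩ :=
      ((tendsto_bound_mersenne.eventually (gt_mem_nhds hε)).and (eventually_ge_atTop 1)).exists
    have hne := linearForm_mersenne_ne_zero hm1
    -- the integers `a = d_n³σ_{n,0}`, `b = d_n³σ_{n,2}` (Lemmas 4.6, 4.5)
    obtain ⟨a, ha⟩ := exists_int_lcm_pow_mul_sigma0 (2 ^ m - 1)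
    obtain ⟨b, hb⟩ := exists_int_lcm_pow_mul_sigma2 (2 ^ m - 1)
    rw [ha, hb] at hm hne
    simp only [Rat.cast_intCast] at hm hne
    refine ⟨![a, b], ?_, fun i => ?_⟩
    · rw [hforms]; exact hne
    · rw [hforms]
      refine lt_of_le_of_lt (mul_le_mul_of_nonneg_right ?_ (norm_nonneg _)) hm
      fin_cases i <;> simp
  obtain ⟨i, hi⟩ := h
  fin_cases i
  · exfalso
    have : ¬ IsIrrational 2 (((1 : ℚ)) : ℚ_[2]) := not_isIrrational_ratCast (p := 2) 1
    simp only [hξ] at hi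
    exact this (by simpa using hi)
  · simpa [hξ] using hi

end Literature.NumberTheory.Irrationality.Lai2025TwoAdic

namespace Literature.NumberTheory.Irrationality.PAdicZetaValues

open Literature.NumberTheory.Irrationality.Lai2025TwoAdic

/-- **Calegari 2005, Theorem 3.3, PROVED: `ζ₂(3) ∉ ℚ`** — discharge of the named fact `calegari2005_theorem33`
(`IsIrrational 2 (padicZetaValue 2 3)`).  Road: Lai's Theorem 1.3 at `s = 0` (`ζ₂(3,¼) ∉ ℚ`,
`Lai2025TwoAdic.isIrrational_padicHurwitzZeta_two_three_quarter`) and Lemma 2.7 (`ζ₂(3) = ½ζ₂(3,¼)`, the tree's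
`lai2025TwoAdic_lemma27_two_holds`) — «The special case `s = 0` of Theorem 1.3 gives an alternative proof of the
irrationality of `ζ₂(3)`».  Calegari's printed proof (overconvergent modular forms of level `Γ₀(2)`, §3.1) is not formalised.
[cite: Calegari2005, Thm 3.3] [cite: Lai2025TwoAdicZeta, Thm 1.3 and §1 (the remark after it), Lemma 2.7] -/
theorem calegari2005_theorem33_holds : calegari2005_theorem33 := by
  unfold calegari2005_theorem33
  rw [isIrrational_iff]
  intro q hq
  have h27 := lai2025TwoAdic_lemma27_two_holds 3 (by decide) le_rfl
  have hirr := isIrrational_padicHurwitzZeta_two_three_quarter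
  rw [isIrrational_iff] at hirr
  refine hirr (2 * q) ?_
  have h2 : padicHurwitzZeta 2 3 (4 : ℚ_[2])⁻¹ = 2 * padicZetaValue 2 3 := by rw [h27]; ring
  rw [h2, ← hq]
  push_cast
  ring

end Literature.NumberTheory.Irrationality.PAdicZetaValues
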